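import Summits.CriticalPhenomena.PercolationContinuityZ3.Theorems.PercNearOneGluingNoHeavyLowerTailSahiGridPatternDiagCertBlockAndT

/-!
# `NoHeavyLowerTail` (crux stmt-CriticalPhenomena-4575), Sahi programme P1: **THE CO-COUNT PRODUCT VECTOR OF A BLOCK-AND** —
# for `S × V` with diagonal data `d_S`, `d_V` put `m_X := 2^{dim+1}·1_X − d_X` ("virtual td-count") and
# `d'(ξ,q) := 2^{n+k+1}·1_S(ξ)1_V(q) − m_S(ξ)·m_V(q)`; then condition (T) for `S × V` follows from (T) for `S` and for `V` (every `n, k`)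

Support file (Sahi cell, seat `prim-sahi-p1`, generation 34; `--supports stmt-CriticalPhenomena-4575`).  Pure proofs, no definitions, no `sorry`,
standard axioms.  Vocabulary of `…SahiGridPattern{,CellForm,SliceForm,DiagCert,DiagCertBlockAndT}` (`Pd`, `glue`, `freeOf`, `cellOf`, `fibre`, `sect`,
`ind`, `nuCount`, `lamU`).

THE MATHEMATICS (seat memo FROM-prim-sahi-p1-gen34, §2).  A diagonal certificate of an up-set `U ⊆ [3]^k` (`…SahiGridPatternDiagCert`) is a vector
`d` with (T) `Σ_{q∈W} d(q) ≤ Σ_{q∈W} λ_U(q)` for every up-set `W` and (N) `Θ_U(P×Q) ≤ d(P∩Q)` for all up-sets `P, Q`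
(`λ_U = 2^{k+1}·1_U − ν_U`).  Generation 29 proved that for a block product `A = S × V ⊆ [3]^{n+k}` the vector `2^n·1_S ⊗ d_V` satisfies (T)
(`diagCert_blockAnd_T`) — but (N) for it holds only for the "Θ-Harris" `S`.  The generation-34 transport analysis of certificates
(`(T) ⟺ d = λ_U + div(downward flow)`, mass law `d(⊤) = λ_U(⊤)`) produces instead, from certificates `d_S` of `S` AND `d_V` of `V`, the
CO-COUNT PRODUCT VECTOR
    `d'(x) = 2^{n+k+1}·1_S(ξ)·1_V(q) − m_S(ξ)·m_V(q)`,   `x = glue ξ q`,   `m_S = 2^{n+1}·1_S − d_S`,  `m_V = 2^{k+1}·1_V − d_V`,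
the analogue for certificates of the factorisation `ν_{S×V} = ν_S ⊗ ν_V` of the td-counts (`λ_X` itself has `m_X = ν_X`); equivalently
`d' = d_S ⊗ d_V − 2·g_S ⊗ g_V` with `g_X = d_X − 2^{dim}·1_X`, mirroring `λ_{S×V} = λ_S ⊗ λ_V − 2·h_S ⊗ h_V`.  It specialises to the cylinder
(`S = ⊤`, `d_S ≡ 2^n`: `d' = 2^n ⊗ d_V`), to the literal-AND steps of `…DiagCertLiteral{,Two}And` and to `2^n·1_S ⊗ d_V` for `d_S = 2^n·1_S`.
**THEOREM (`diagCert_coProduct_T`, every `n, k`; `S, V` arbitrary finsets).**  If `d_S` satisfies (T) for `S`, `d_V` satisfies (T) for `V`, and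
`d_S ≤ 2^{n+1}·1_S` pointwise (i.e. `m_S ≥ 0`), then `d'` satisfies (T) for `S × V`.  PROOF — the two-line identity (`lamU_sub_coProduct_pointwise`)
    `λ_{S×V}(x) − d'(x) = m_S(ξ)·(λ_V(q) − d_V(q)) + ν_V(q)·(λ_S(ξ) − d_S(ξ))`
summed over an up-set `W` by sections `W^ξ` (first term, (T) for `V`, weight `m_S(ξ) ≥ 0`) and by fibres `W_q` (second term, (T) for `S`, weight
`ν_V(q) ≥ 0`).  No sign or monotonicity hypothesis on `d_V`, `S`, `V` is needed.
STATUS OF (N) (honest label).  Condition (N) for `d'` is NOT proved here.  Evidence (seat memo §2, kit jobs j253488, j253910): for `(n,k) = (1,2)` and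
ALL integer certificates of all up-sets of `[3]` and `[3]^2` (3 700 pairs) (N) holds exactly (all `980^2` test pairs of `[3]^3`); for `(2,2)` it holds in
every sampled certificate pair (heuristic adversary, 4 000 pairs; exact over all `17 792 748` up-sets of `[3]^4` for 16+ pairs); `0` counterexamples.
It is recorded as a CONJECTURE in the memo, not asserted in this file.  Nothing here asserts `PatternPos d` for `d ≥ 4`. [this work]
-/

namespace Summit.CriticalPhenomena.PercolationContinuityZ3.Theorems.SahiGridPattern

open Finset SahiGrid3
open scoped BigOperators

variable {n k : ℕ} {S : Finset (Pd n)} {V : Finset (Pd k)} {A : Finset (Pd (n + k))}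

/-- The fibre sum `Σ_ξ 1_W(glue ξ q)·G(ξ) = Σ_{ξ ∈ W_q} G(ξ)`. [this work] -/
theorem sum_ind_glue_mul_eq_sum_fibre (W : Finset (Pd (n + k))) (q : Pd k) (G : Pd n → ℤ) :
    (∑ ξ : Pd n, ind W (glue ξ q) * G ξ) = ∑ ξ ∈ fibre W q, G ξ := by
  rw [sum_mem_eq_sum_ind_mul (fibre W q) G]
  refine Finset.sum_congr rfl fun ξ _ => ?_
  rw [ind_fibre]

/-- **The pointwise identity behind the co-count product**: at `x = glue ξ q`,
`λ_{S×V}(x) − d'(x) = m_S(ξ)·(λ_V(q) − d_V(q)) + ν_V(q)·(λ_S(ξ) − d_S(ξ))`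
with `m_S = 2^{n+1}1_S − d_S` and `d' = 2^{n+k+1}1_S1_V − m_S m_V`. [this work] -/
theorem lamU_sub_coProduct_pointwise (hA : ∀ ξ z, glue ξ z ∈ A ↔ (ξ ∈ S ∧ z ∈ V)) (dS : Pd n → ℤ) (dV : Pd k → ℤ) (ξ : Pd n) (q : Pd k) :
    lamU A (glue ξ q) - (2 * (2:ℤ) ^ (n + k) * (ind S ξ * ind V q)
        - (2 * (2:ℤ) ^ n * ind S ξ - dS ξ) * (2 * (2:ℤ) ^ k * ind V q - dV q))
      = (2 * (2:ℤ) ^ n * ind S ξ - dS ξ) * (lamU V q - dV q) + (nuCount V q : ℤ) * (lamU S ξ - dS ξ) := by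
  rw [lamU_blockAnd hA]
  unfold lamU
  rw [pow_add]
  ring

/-- **THEOREM (`(T)` for the co-count product vector of a block-AND; every `n, k`).**  Let `S ⊆ [3]^n`, `V ⊆ [3]^k` be arbitrary finsets,
`A = S × V` (`glue ξ z ∈ A ↔ ξ ∈ S ∧ z ∈ V`), `d_S` with (T) for `S` and `d_S ≤ 2^{n+1}·1_S` pointwise, `d_V` with (T) for `V`.  Then
`d'(x) = 2^{n+k+1}·1_S(freeOf x)1_V(cellOf x) − (2^{n+1}1_S − d_S)(freeOf x)·(2^{k+1}1_V − d_V)(cellOf x)` satisfies (T) for `A`: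
`Σ_{x∈W} d'(x) ≤ Σ_{x∈W} λ_A(x)` for every up-set `W ⊆ [3]^{n+k}`. [this work] -/
theorem diagCert_coProduct_T (hA : ∀ ξ z, glue ξ z ∈ A ↔ (ξ ∈ S ∧ z ∈ V)) (dS : Pd n → ℤ) (dV : Pd k → ℤ)
    (hTS : ∀ W : Finset (Pd n), IsUpperSet (W : Set (Pd n)) → (∑ ξ ∈ W, dS ξ) ≤ ∑ ξ ∈ W, lamU S ξ)
    (hTV : ∀ W : Finset (Pd k), IsUpperSet (W : Set (Pd k)) → (∑ q ∈ W, dV q) ≤ ∑ q ∈ W, lamU V q)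
    (hmS : ∀ ξ : Pd n, dS ξ ≤ 2 * (2:ℤ) ^ n * ind S ξ)
    {W : Finset (Pd (n + k))} (hW : IsUpperSet (W : Set (Pd (n + k)))) :
    (∑ x ∈ W, (2 * (2:ℤ) ^ (n + k) * (ind S (freeOf x) * ind V (cellOf x))
        - (2 * (2:ℤ) ^ n * ind S (freeOf x) - dS (freeOf x)) * (2 * (2:ℤ) ^ k * ind V (cellOf x) - dV (cellOf x))))
      ≤ ∑ x ∈ W, lamU A x := by
  rw [← sub_nonneg, ← Finset.sum_sub_distrib, sum_mem_eq_sum_glue]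
  simp only [freeOf_glue, cellOf_glue]
  have hpt : ∀ (ξ : Pd n) (q : Pd k), ind W (glue ξ q) * (lamU A (glue ξ q) - (2 * (2:ℤ) ^ (n + k) * (ind S ξ * ind V q)
        - (2 * (2:ℤ) ^ n * ind S ξ - dS ξ) * (2 * (2:ℤ) ^ k * ind V q - dV q)))
      = (2 * (2:ℤ) ^ n * ind S ξ - dS ξ) * (ind W (glue ξ q) * (lamU V q - dV q))
        + (nuCount V q : ℤ) * (ind W (glue ξ q) * (lamU S ξ - dS ξ)) := by
    intro ξ q
    rw [lamU_sub_coProduct_pointwise hA dS dV ξ q]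
    ring
  simp only [hpt, Finset.sum_add_distrib]
  -- first block: sections `W^ξ`, (T) for `V`, weight `m_S(ξ) ≥ 0`
  have h1 : 0 ≤ ∑ ξ : Pd n, ∑ q : Pd k, (2 * (2:ℤ) ^ n * ind S ξ - dS ξ) * (ind W (glue ξ q) * (lamU V q - dV q)) := by
    refine Finset.sum_nonneg fun ξ _ => ?_
    rw [← Finset.mul_sum, sum_ind_glue_mul_eq_sum_sect, Finset.sum_sub_distrib]
    refine mul_nonneg (by linarith [hmS ξ]) ?_
    linarith [hTV (sect W ξ) (isUpperSet_sect hW ξ)]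
  -- second block: fibres `W_q`, (T) for `S`, weight `ν_V(q) ≥ 0`
  have h2 : 0 ≤ ∑ ξ : Pd n, ∑ q : Pd k, (nuCount V q : ℤ) * (ind W (glue ξ q) * (lamU S ξ - dS ξ)) := by
    rw [Finset.sum_comm]
    refine Finset.sum_nonneg fun q _ => ?_
    rw [← Finset.mul_sum, sum_ind_glue_mul_eq_sum_fibre, Finset.sum_sub_distrib]
    refine mul_nonneg (by exact_mod_cast Nat.zero_le _) ?_
    linarith [hTS (fibre W q) (isUpperSet_fibre hW q)]
  linarith

/-- The co-count product vector VANISHES OFF `S × V` when `d_S`, `d_V` vanish off `S`, `V` (then `m_S = 0` off `S`, `m_V = 0` off `V`). [this work] -/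
theorem coProduct_eq_zero_of_not_mem (dS : Pd n → ℤ) (dV : Pd k → ℤ) (hS0 : ∀ ξ, ξ ∉ S → dS ξ = 0) (hV0 : ∀ q, q ∉ V → dV q = 0)
    (ξ : Pd n) (q : Pd k) (h : ¬ (ξ ∈ S ∧ q ∈ V)) :
    (2 * (2:ℤ) ^ (n + k) * (ind S ξ * ind V q)
        - (2 * (2:ℤ) ^ n * ind S ξ - dS ξ) * (2 * (2:ℤ) ^ k * ind V q - dV q)) = 0 := by
  by_cases hξ : ξ ∈ S
  · have hq : q ∉ V := fun hq => h ⟨hξ, hq⟩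
    have e1 : ind V q = 0 := by unfold ind; rw [if_neg hq]
    rw [e1, hV0 q hq]; ring
  · have e1 : ind S ξ = 0 := by unfold ind; rw [if_neg hξ]
    rw [e1, hS0 ξ hξ]; ring

/-- On `S × V` the co-count product vector equals `d_S ⊗ d_V − 2·g_S ⊗ g_V` with `g_X = d_X − 2^{dim}·1_X` (the form mirroring
`λ_{S×V} = λ_S ⊗ λ_V − 2 h_S ⊗ h_V`). [this work] -/
theorem coProduct_eq_tensor_sub (dS : Pd n → ℤ) (dV : Pd k → ℤ) (ξ : Pd n) (q : Pd k) (hξ : ξ ∈ S) (hq : q ∈ V) :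
    (2 * (2:ℤ) ^ (n + k) * (ind S ξ * ind V q)
        - (2 * (2:ℤ) ^ n * ind S ξ - dS ξ) * (2 * (2:ℤ) ^ k * ind V q - dV q))
      = dS ξ * dV q - 2 * ((dS ξ - (2:ℤ) ^ n) * (dV q - (2:ℤ) ^ k)) := by
  have e1 : ind S ξ = 1 := by unfold ind; rw [if_pos hξ]
  have e2 : ind V q = 1 := by unfold ind; rw [if_pos hq]
  rw [e1, e2, pow_add]; ring

/-- **The cylinder and the trivial-vector instances.**  With `d_S = 2^n·1_S` (so `m_S = 2^n·1_S`) the co-count product vector is generation 29's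
`2^n·1_S ⊗ d_V`; in particular for `S = ⊤` it is the cylinder vector `2^n ⊗ d_V`. [this work] -/
theorem coProduct_of_trivial (dV : Pd k → ℤ) (ξ : Pd n) (q : Pd k) :
    (2 * (2:ℤ) ^ (n + k) * (ind S ξ * ind V q)
        - (2 * (2:ℤ) ^ n * ind S ξ - (2:ℤ) ^ n * ind S ξ) * (2 * (2:ℤ) ^ k * ind V q - dV q))
      = (2:ℤ) ^ n * ind S ξ * dV q := by
  rw [pow_add]; ring

end Summit.CriticalPhenomena.PercolationContinuityZ3.Theorems.SahiGridPattern
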